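import Literature.AnabelianGeometry.AbsoluteAnabelian.AbsTopIChainsCuspidalSplitSurfaceModel
import Literature.AnabelianGeometry.SemiGraphs.ProSigmaSurfaceHandleSwap
import HarnessLib

/-!
# [AbsTopI] Lemma 4.5 (v) at split data, ONE cusp: F-0206 fails at `G × Δ` for every hyperbolic
# type `(g, r)`, `r ≥ 1`, except the once-punctured torus `(1, 1)`

Mochizuki, *Topics in Absolute Anabelian Geometry I* [AbsTopI], Lemma 4.5 (v) p. 55 ("a
group-theoretic characterization of the decomposition groups of cusps in `Π`" — FACT-LIST row F-0206
`CuspidalAlgorithm.RecoversCusps`); (vi) p. 55 (F-0207); *Semi-graphs of anabelioids* [SemiAnbd]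
Example 2.10 p. 31 (pro-`Σ` surface groups and their cusp inertia subgroups).

PROOF-ONLY file (abc-iut cell, seat abc-iut-f-060 gen 6; complement to abc-iut-f-060 gen 5's
`AbsTopIChainsCuspidalSplitSurfaceModel.lean`).  That file builds, for every profinite `G`, nonempty
set of primes `Σ` and hyperbolic `(g, r)`, the SPLIT datum `(E = (G × Δ ↠ G), C)` over a pro-`Σ`
completion `Δ` of `Γ_{g,r}` with all `r` cusps marked (`exists_split_surfaceGroup_model`: F-0207 /
F-0003 / F-0405 hold there, and F-0206 fails as soon as a continuous automorphism of `Δ` moves a cusp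
inertia class off every cuspidal class), and refutes F-0206 there for `r ≥ 2` via the transvection
`c₁ ↦ c₁ s²`.  Here the remaining ONE-CUSP types are settled for genus `≥ 2` by the HANDLE SWAP
`a₁ ↔ b₁` (`IsProSigmaCompletion.exists_continuousMulEquiv_map_cuspInertia_not_conj_of_genus`,
detected by a Heisenberg-group character):

* `exists_split_surfaceGroup_model_not_recoversCusps_of_genus`: genus `g ≥ 2`, any `r ≥ 1` cusps;
* `exists_split_oneCusp_not_recoversCusps`: the one-cusp surfaces `(g, 1)`, `g ≥ 2`;
* `exists_split_surfaceGroup_model_not_recoversCusps_of_ne`: EVERY hyperbolic `(g, r)` with `r ≥ 1`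
  other than `(1, 1)` (the transvection for `r ≥ 2`, the handle swap for `r = 1`).

HONEST SCOPE: the once-punctured torus `(1, 1)` is NOT covered — there `Γ_{1,1} = F(a, b)`,
`c = [a,b]⁻¹`, every automorphism of the DISCRETE free group fixes the class of `[a,b]^{±1}` (Nielsen)
and the question whether a continuous automorphism of the free pro-`Σ` group of rank 2 can move the
conjugacy class of `closure⟨[a,b]⟩` is left open here.  Classical profinite group theory; it shows the
arithmetic input (iii) (weights) of Lemma 4.5 (v) is load-bearing; nothing here bears on [IUTchIII]
Cor 3.12; no abc claim; typed ≠ proved-in-print.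
-/

noncomputable section

open scoped Pointwise

namespace Literature.AnabelianGeometry.AbsoluteAnabelian.FundamentalExtension

open Literature.AnabelianGeometry.SemiGraphs
open Literature.AnabelianGeometry.SemiGraphs.SemiGraphOfAnabelioids
open Literature.GroupTheory.CombinatorialGroupTheory

/-- **F-0206 is FALSE at genuine geometric data of genus `≥ 2` with trivial arithmetic action — any
number `≥ 1` of cusps, in particular ONE — while F-0207 / F-0003 / F-0405 hold there.**  For every
profinite `G`, nonempty set of primes `Σ`, `g ≥ 2` and `r ≥ 1`: at the split extension `G × Δ` over a
pro-`Σ` completion `Δ` of `Γ_{g,r}` with all `r` cusps marked (`exists_split_surfaceGroup_model`),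
(vi) holds and NO functorial group-theoretic cuspidal algorithm recovers the cusps — the automorphism of
`Δ` extending the handle swap `a₁ ↔ b₁` (`exists_continuousMulEquiv_map_cuspInertia_not_conj_of_genus`)
moves the class of the cusp `c₁`.  [AbsTopI] Lemma 4.5 (v) needs its arithmetic input (iii).
[cite: MochizukiAbsTopI2012, Lemma 4.5 (v)(vi) p.55] [cite: MochizukiSemiAnbd2006, Ex. 2.10 p.31] -/
theorem CuspidalData.exists_split_surfaceGroup_model_not_recoversCusps_of_genus (G : ProfiniteGrp.{0})
    {Sigma : Set ℕ} (hne : Sigma.Nonempty) (hprime : ∀ p ∈ Sigma, p.Prime) (g r : ℕ) :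
    ∃ (Q : ProfiniteGrp.{0}) (ι : PuncturedSurfaceGroup (g + 2) (r + 1) →* Q)
      (E : FundamentalExtension.{0}) (C : CuspidalData E) (j : C.Cusp ≃ Fin (r + 1)),
      IsProSigmaCompletion Sigma ι ∧ E.gal = G ∧ E.arith = ProfiniteGrp.of (G × Q) ∧
      (∀ x, Nonempty (↥(C.Icusp x) ≃ₜ*
        ↥((PuncturedSurfaceGroup.cuspInertia (g := g + 2) (j x)).map ι).topologicalClosure)) ∧
      C.DecompEqCommensuratorOfInertia ∧ C.InertiaCommensurablyTerminal ∧ C.DecompEqNormalizer ∧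
      ¬ ∃ A : CuspidalAlgorithm.{0}, A.RecoversCusps E C := by
  have hgr : PuncturedSurfaceGroup.IsHyperbolicType (g + 2) (r + 1) := by
    unfold PuncturedSurfaceGroup.IsHyperbolicType; omega
  obtain ⟨Q, ι, E, C, j, hι, hG, hPi, hI, hvi, h137, h111, hneg⟩ :=
    CuspidalData.exists_split_surfaceGroup_model G hne hprime (g + 2) (r + 1) hgr
  refine ⟨Q, ι, E, C, j, hι, hG, hPi, hI, hvi, h137, h111, hneg (j.symm 0) ?_⟩
  obtain ⟨e, he⟩ :=
    IsProSigmaCompletion.exists_continuousMulEquiv_map_cuspInertia_not_conj_of_genus hne hprime ι hι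
  refine ⟨e, fun y q => ?_⟩
  rw [Equiv.apply_symm_apply]
  exact he y q

/-- **The one-cusp surfaces `(g, 1)`, `g ≥ 2`.**  For every profinite `G`, nonempty set of primes `Σ`
and `g ≥ 2`: at `Π = G × Δ`, `Δ` a pro-`Σ` completion of the one-cusp surface group `Γ_{g,1}`
(`c₁ = (∏ᵢ[aᵢ,bᵢ])⁻¹`) with its single cusp marked, [AbsTopI] Lemma 4.5 (vi) (F-0207), [AbsAnab]
Lemma 1.3.7 (F-0003) and [AbsTopIII] Thm 1.11 (b) (F-0405) HOLD and Lemma 4.5 (v) (F-0206) FAILS: no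
group-theoretic cuspidal algorithm recovers the (single) cusp, although every abelian character of `Δ`
is blind to it.  [cite: MochizukiAbsTopI2012, Lemma 4.5 (v)(vi) p.55] -/
theorem CuspidalData.exists_split_oneCusp_not_recoversCusps (G : ProfiniteGrp.{0}) {Sigma : Set ℕ}
    (hne : Sigma.Nonempty) (hprime : ∀ p ∈ Sigma, p.Prime) (g : ℕ) :
    ∃ (Q : ProfiniteGrp.{0}) (ι : PuncturedSurfaceGroup (g + 2) 1 →* Q)
      (E : FundamentalExtension.{0}) (C : CuspidalData E), IsProSigmaCompletion Sigma ι ∧ E.gal = G ∧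
      E.arith = ProfiniteGrp.of (G × Q) ∧ Nonempty (C.Cusp ≃ Fin 1) ∧
      C.DecompEqCommensuratorOfInertia ∧ C.InertiaCommensurablyTerminal ∧ C.DecompEqNormalizer ∧
      ¬ ∃ A : CuspidalAlgorithm.{0}, A.RecoversCusps E C := by
  obtain ⟨Q, ι, E, C, j, hι, hG, hPi, -, hvi, h137, h111, hneg⟩ :=
    CuspidalData.exists_split_surfaceGroup_model_not_recoversCusps_of_genus G hne hprime g 0
  exact ⟨Q, ι, E, C, hι, hG, hPi, ⟨j⟩, hvi, h137, h111, hneg⟩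

/-- **F-0206 fails at the split datum for EVERY hyperbolic type `(g, r)` with `r ≥ 1` cusps other
than the once-punctured torus `(1, 1)`** (while F-0207 / F-0003 / F-0405 hold there): for `r ≥ 2` by
the transvection `c₁ ↦ c₁ s²` (abc-iut-f-060 gen 5, `exists_split_surfaceGroup_model_not_recoversCusps`),
for `r = 1` (then `g ≥ 2`) by the handle swap `a₁ ↔ b₁`.  The type `(1, 1)` — `Γ_{1,1} = F(a,b)`,
`c = [a,b]⁻¹`, whose class every automorphism of the DISCRETE free group preserves up to sign
(Nielsen) — is the one case not decided in the tree.
[cite: MochizukiAbsTopI2012, Lemma 4.5 (v)(vi) p.55] [cite: MochizukiSemiAnbd2006, Ex. 2.10 p.31] -/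
theorem CuspidalData.exists_split_surfaceGroup_model_not_recoversCusps_of_ne (G : ProfiniteGrp.{0})
    {Sigma : Set ℕ} (hne : Sigma.Nonempty) (hprime : ∀ p ∈ Sigma, p.Prime) (g r : ℕ)
    (hgr : PuncturedSurfaceGroup.IsHyperbolicType g (r + 1)) (h11 : (g, r + 1) ≠ (1, 1)) :
    ∃ (Q : ProfiniteGrp.{0}) (ι : PuncturedSurfaceGroup g (r + 1) →* Q)
      (E : FundamentalExtension.{0}) (C : CuspidalData E) (j : C.Cusp ≃ Fin (r + 1)),
      IsProSigmaCompletion Sigma ι ∧ E.gal = G ∧ E.arith = ProfiniteGrp.of (G × Q) ∧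
      (∀ x, Nonempty (↥(C.Icusp x) ≃ₜ*
        ↥((PuncturedSurfaceGroup.cuspInertia (g := g) (j x)).map ι).topologicalClosure)) ∧
      C.DecompEqCommensuratorOfInertia ∧ C.InertiaCommensurablyTerminal ∧ C.DecompEqNormalizer ∧
      ¬ ∃ A : CuspidalAlgorithm.{0}, A.RecoversCusps E C := by
  rcases r with _ | r
  · -- one cusp: `g ≥ 2`
    obtain ⟨g', rfl⟩ : ∃ g', g = g' + 2 :=
      ⟨g - 2, by unfold PuncturedSurfaceGroup.IsHyperbolicType at hgr; simp at h11; omega⟩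
    exact CuspidalData.exists_split_surfaceGroup_model_not_recoversCusps_of_genus G hne hprime g' 0
  · -- at least two cusps: the transvection
    exact CuspidalData.exists_split_surfaceGroup_model_not_recoversCusps G hne hprime g r hgr

end Literature.AnabelianGeometry.AbsoluteAnabelian.FundamentalExtension

end
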